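import Literature.NumberTheory.Transcendental.SixExponentialsSeveralVariables
import Literature.NumberTheory.Transcendental.PeriodsWave0
import HarnessLib

/-!
# Waldschmidt 1981, Théorème 1.1 for `n = 1` is the six exponentials theorem

Topic `Literature/NumberTheory/Transcendental`; sibling proof file of
`SixExponentialsSeveralVariables.lean` (the named fact `Waldschmidt1981.thm_1_1`,
[Waldschmidt1981, Théorème 1.1]). The source introduces Théorème 1.1 (p. 98) as the
generalisation to several variables of

> "Le théorème des six exponentielles, dû à Siegel, Lang et Ramachandra … Soient `x₁, x₂` deux
> nombres complexes `ℚ`-linéairement indépendants, et `y₁, y₂, y₃` trois nombres complexes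
> `ℚ`-linéairement indépendants. Alors l'un au moins des six nombres `exp(xᵢyⱼ)`
> `(i = 1, 2; j = 1, 2, 3)` est transcendant."

This file PROVES that specialisation for the tree's rendering — a faithfulness check of the
vendored statement (in particular of the division-free rendering `d · n₁ < d₁ · n` of
"`d₁/n₁ > d/n`"): `six_exponentials_of_thm_1_1 : thm_1_1 → six_exponentials`, where
`Literature.NumberTheory.Transcendental.six_exponentials` (`PeriodsWave0.lean`, **periods.S14**) is
the tree's statement of the six exponentials theorem (itself discharged independently, by
Schneider's method in one variable, in `SixExponentials.lean` / `SixExponentialsProofs.lean`).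

The argument: with `n = 1`, `d = 2`, `ℓ = 3` one has `ℓd = 6 > 5 = n(ℓ + d)`; if all six values
were algebraic, Théorème 1.1 would give `X₁ ≤ X` of rank `d₁ ≤ 2` with `2 · n₁ < d₁ · 1`, where
`n₁ = dim_ℂ span X₁ ≤ 1`: `n₁ = 1` forces `d₁ > 2`, and `n₁ = 0` forces `X₁ = 0`, `d₁ = 0 > 0` —
impossible either way. (For `n = 1` the conclusion of Théorème 1.1 is never satisfiable: the
theorem says that the hypotheses are contradictory, which is the six exponentials theorem.)

## References

* [Waldschmidt1981] M. Waldschmidt, *Transcendance et exponentielles en plusieurs variables*,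
  Invent. Math. 63 (1981) 97–127, §1 (p. 98).
-/

noncomputable section

open Complex Matrix Module

namespace Literature.NumberTheory.Transcendental.Waldschmidt1981

/-- A `ℚ`-linearly independent family of complex numbers, viewed in `ℂ¹ = (Fin 1 → ℂ)`, is
`ℤ`-linearly independent. [folklore] -/
theorem linearIndependent_int_const_of_rat {m : ℕ} {x : Fin m → ℂ} (hx : LinearIndependent ℚ x) :
    LinearIndependent ℤ (fun i => fun _ : Fin 1 => x i) := by
  have hinj : Function.Injective fun n : ℤ => n • (1 : ℚ) := by
    intro a b hab
    simpa using hab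
  have hxZ : LinearIndependent ℤ x := hx.restrict_scalars hinj
  rw [Fintype.linearIndependent_iff]
  intro g hg i
  have h0 := congr_fun hg 0
  simp only [Finset.sum_apply, Pi.smul_apply, Pi.zero_apply] at h0
  exact Fintype.linearIndependent_iff.mp hxZ g h0 i

/-- **Théorème 1.1 with `n = 1` gives the six exponentials theorem** (the statement it
generalises, p. 98): the tree's `six_exponentials` (**periods.S14**) follows from `thm_1_1`.
[cite: Waldschmidt1981, §1 (p. 98)] -/
theorem six_exponentials_of_thm_1_1 (h11 : thm_1_1) : six_exponentials := by
  intro x y hx hy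
  classical
  by_contra hcon
  push Not at hcon
  simp only [Transcendental, not_not] at hcon
  -- the data in `ℂ¹`
  set x' : Fin 2 → Fin 1 → ℂ := fun i _ => x i with hx'def
  set y' : Fin 3 → Fin 1 → ℂ := fun j _ => y j with hy'def
  have hx' : LinearIndependent ℤ x' := linearIndependent_int_const_of_rat hx
  have hy' : LinearIndependent ℤ y' := linearIndependent_int_const_of_rat hy
  have hdot : ∀ i j, x' i ⬝ᵥ y' j = x i * y j := by
    intro i j
    simp [dotProduct, hx'def, hy'def]
  have halg : ∀ i j, IsAlgebraic ℚ (cexp (x' i ⬝ᵥ y' j)) := fun i j => by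
    rw [hdot]; exact hcon i j
  obtain ⟨X₁, X₂, Y₁, Y₂, hXsup, -, -, -, -, hlt, -⟩ :=
    h11 x' y' hx' hy' (by norm_num) halg
  -- `d₁ ≤ 2`
  set X : Submodule ℤ (Fin 1 → ℂ) := Submodule.span ℤ (Set.range x') with hXdef
  haveI : Module.Finite ℤ X := Module.Finite.iff_fg.mpr (Submodule.fg_span (Set.finite_range x'))
  have hX₁X : X₁ ≤ X := hXsup ▸ le_sup_left
  have hd₁ : finrank ℤ X₁ ≤ 2 := by
    calc finrank ℤ X₁ ≤ finrank ℤ X := Submodule.finrank_mono hX₁X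
      _ ≤ Fintype.card (Fin 2) := finrank_range_le_card x'
      _ = 2 := Fintype.card_fin 2
  -- `n₁ ≤ 1`
  set n₁ := finrank ℂ (Submodule.span ℂ (X₁ : Set (Fin 1 → ℂ))) with hn₁def
  have hn₁ : n₁ ≤ 1 := by
    have := Submodule.finrank_le (Submodule.span ℂ (X₁ : Set (Fin 1 → ℂ)))
    rwa [Module.finrank_fin_fun] at this
  rw [Nat.mul_one] at hlt
  -- `hlt : 2 * n₁ < finrank ℤ X₁`
  rcases Nat.le_one_iff_eq_zero_or_eq_one.mp hn₁ with h0 | h1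
  · -- `n₁ = 0`: `X₁ = 0`
    have hbot : Submodule.span ℂ (X₁ : Set (Fin 1 → ℂ)) = ⊥ :=
      Submodule.finrank_eq_zero.mp (hn₁def ▸ h0)
    have hX₁ : X₁ = ⊥ := by
      rw [eq_bot_iff]
      intro u hu
      have : u ∈ Submodule.span ℂ (X₁ : Set (Fin 1 → ℂ)) := Submodule.subset_span hu
      rw [hbot] at this
      exact this
    rw [hX₁, finrank_bot] at hlt
    exact Nat.not_lt_zero _ hlt
  · rw [h1] at hlt
    omega

end Literature.NumberTheory.Transcendental.Waldschmidt1981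

end
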